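import Summits.ResolutionOfSingularities.ResolutionOfSingularities.Theorems.UniformComplexityCampaignW82TwistNormalRing
import Summits.ResolutionOfSingularities.ResolutionOfSingularities.Theorems.UniformComplexityCampaignW82HypersurfaceBaseChange
import Mathlib.FieldTheory.IsAlgClosed.AlgebraicClosure
import Mathlib.LinearAlgebra.TensorProduct.RightExactness
import Mathlib.RingTheory.Localization.FractionRing
import HarnessLib

/-!
# [OURS · L1 W8.2] Disproof near-miss (s2) VERBATIM: `F[u,y,z]/(u^p + y² + z²)` is a normal, non-regular domain (`p` odd)

Cell `res-hironaka` (run/shared/lean/pub/res-hironaka/), LADDER-RESOLUTION rung L (RESCUE), slot W8.2 of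
plan/RESCUE-SEED.md, door 2 = route `UniformComplexity`, host item `PrimeModelTransfer`
(stmt-ResolutionOfSingularities-8933); prover res-L1-s82-pv-2 (gen 4). THESES-FREE module (imports the gen-4 siblings
`…TwistNormalRing` (`ApQuot F p = F[u,y,z]/(u^p − yz)`: `isDomain_apQuot`, `isIntegrallyClosed_apQuot`; the Jacobian
lemma through `…TwistExponentNormalization`) and `…HypersurfaceBaseChange` (`hypTensorEquiv`), Mathlib, `HarnessLib`).

[OURS · L1 W8.2] replaces the role of no printed item; NOT a statement of H. Hironaka's manuscript. This file PROVES,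
with the same binders and the same `let`, the sorried near-miss (s2) of Cruxes/PrimeFieldToPerfect/Disproof.lean §4
(`twistedSurface_normal_not_regular`, strategist census N3 «NORMALISE the twists, never re-resolve» fails from
dimension 2): for every ODD prime `p` and EVERY field `F` of characteristic `p`, `Z_F = F[u,y,z]/(u^p + y² + z²)` is a
DOMAIN, INTEGRALLY CLOSED, and NOT a regular ring (`twistedSurface_normal_not_regular`). The disprover may replace its
`sorry` by `exact` this theorem. Route:

* §14 `isIntegrallyClosed_of_retraction` (normality of a pure subring: `φ : R ↪ B` into a normal domain with an
  additive retraction `ρ`, `ρ(b·φ s) = ρ(b)·s`), `tensorRetraction` (`A ⊗_F F' → A`, `a ⊗ x ↦ g(x)a` for an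
  `F`-linear retraction `g` of `F → F'`), hence **`isIntegrallyClosed_of_baseChange`** / `isDomain_of_baseChange`:
  NORMALITY AND INTEGRALITY DESCEND ALONG FIELD EXTENSIONS (`A ⊗_F F'` a normal domain ⇒ `A` a normal domain);
* §15 `sosPoly = X₀^p + X₁² + X₂²`, `SosRing`; non-regularity at the origin for EVERY `p` and `F` by the tree's
  Jacobian criterion (`not_isRegularRing_sosRing`); over a field with `i² = −1` and `2 ≠ 0` the change of variables
  `y ↦ y + iz`, `z ↦ −y + iz` (`sosEquiv`, an `F`-algebra automorphism of `F[u,y,z]`) carries `u^p − yz` to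
  `u^p + y² + z²` (`sosEquiv_apPoly`), so `Z_F ≅ ApQuot F p` is a normal domain there
  (`isDomain_and_isIntegrallyClosed_sosRing_of_sqrt`);
* §16 `Z_F ⊗_F F̄ ≅ Z_{F̄}` (`sosRingTensorEquiv`, generic hypersurface base change) and descent give the theorem.

HONEST FRAMING. OURS support for the crux chain's disprover; classical mathematics; NOT a statement of H. Hironaka's
2017 manuscript ([Hironaka2017]); nothing attributed to its author. AI work, weaker than expert review. No `sorry`,
no new axioms.

## References (locators only)
* Zs. Patakfalvi, J. Waldron, *Singularities of general fibers and the LMMP*, arXiv:1708.04268, Thm 1.1, §2.4.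
* H. Matsumura, *Commutative Ring Theory* (1986), §9 (pure subrings / descent of normality), Thm. 14.2.
* Cruxes/PrimeFieldToPerfect/Disproof.lean §4 (s2); Cruxes/PrimeModelTransfer/STRATEGY-CENSUS.md N3.
-/

noncomputable section

set_option linter.dupNamespace false -- mandated namespace of this single-conjunct summit

open Polynomial IsLocalRing TensorProduct
open _root_.CategoryTheory _root_.CategoryTheory.Limits _root_.AlgebraicGeometry

namespace Summit.ResolutionOfSingularities.ResolutionOfSingularities.Theorems.CampaignW82.TwistNormal

open Literature.AlgebraicGeometry.Resolution

/-! ## §14 Normality through a retraction (pure subrings), and descent along field extensions -/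

/-- **Normality via a retraction.** Let `φ : R → B` be a ring map of domains, `B` integrally closed, and
`ρ : B → R` an additive retraction (`ρ (φ r) = r`) which is `R`-linear for right multiplication by `φ(R)`
(`ρ (b · φ s) = ρ b · s`). Then `R` is integrally closed: `r/s ↦ b ∈ B` with `b·φ(s) = φ(r)`, so
`ρ(b)·s = r`. [folklore] -/
theorem isIntegrallyClosed_of_retraction {R B : Type*} [CommRing R] [IsDomain R] [CommRing B] [IsDomain B]
    [IsIntegrallyClosed B] (φ : R →+* B) (ρ : B →+ R) (hρ : ∀ r, ρ (φ r) = r)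
    (hρmul : ∀ b s, ρ (b * φ s) = ρ b * s) : IsIntegrallyClosed R := by
  have hφ : Function.Injective φ := fun a b h => by rw [← hρ a, ← hρ b, h]
  let K := FractionRing R
  let L := FractionRing B
  have hφ0 : ∀ {s : R}, s ≠ 0 → φ s ≠ 0 := fun hs h0 => hs (hφ (by rw [h0, map_zero]))
  have hle : nonZeroDivisors R ≤ (nonZeroDivisors B).comap φ := fun s hs =>
    mem_nonZeroDivisors_of_ne_zero (hφ0 (nonZeroDivisors.ne_zero hs))
  let ψ : K →+* L := IsLocalization.map L φ hle
  refine (isIntegrallyClosed_iff K).mpr fun {x} hx => ?_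
  obtain ⟨⟨r, s⟩, rfl⟩ := IsLocalization.mk'_surjective (nonZeroDivisors R) x
  have hint : IsIntegral B (ψ (IsLocalization.mk' K r s)) := by
    obtain ⟨P, hPm, hP⟩ := hx
    refine ⟨P.map φ, hPm.map φ, ?_⟩
    have hcomp : (algebraMap B L).comp φ = ψ.comp (algebraMap R K) := by
      ext a
      simp [ψ]
    rw [Polynomial.eval₂_map, hcomp, ← Polynomial.hom_eval₂, hP, map_zero]
  obtain ⟨b, hb⟩ := (IsIntegrallyClosed.isIntegral_iff (R := B) (K := L)).mp hint
  rw [IsLocalization.map_mk'] at hb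
  have hbs : b * φ s = φ r := by
    have h := (IsLocalization.eq_mk'_iff_mul_eq).mp hb
    simp only at h
    rw [← map_mul] at h
    exact IsFractionRing.injective B L h
  refine ⟨ρ b, ?_⟩
  rw [IsLocalization.eq_mk'_iff_mul_eq, ← map_mul]
  congr 1
  rw [← hρmul, hbs, hρ]

/-- **The retraction `A ⊗_F F' → A` attached to an `F`-linear retraction `g : F' → F`**: `a ⊗ x ↦ g(x) · a`.
[folklore] -/
def tensorRetraction {F : Type} [Field F] (A : Type) [CommRing A] [Algebra F A] {F' : Type} [Field F']
    [Algebra F F'] (g : F' →ₗ[F] F) : A ⊗[F] F' →ₗ[F] A :=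
  (TensorProduct.rid F A).toLinearMap ∘ₗ LinearMap.lTensor A g

/-- `tensorRetraction` on pure tensors. [folklore] -/
theorem tensorRetraction_tmul {F : Type} [Field F] (A : Type) [CommRing A] [Algebra F A] {F' : Type} [Field F']
    [Algebra F F'] (g : F' →ₗ[F] F) (a : A) (x : F') : tensorRetraction A g (a ⊗ₜ x) = g x • a := by
  simp [tensorRetraction]

/-- **Normality descends along field extensions**: if `A ⊗_F F'` is an integrally closed domain for a field
extension `F'/F`, so is the `F`-algebra `A` (`A → A ⊗_F F'` admits the retraction `a ⊗ x ↦ g(x)a` for any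
`F`-linear `g : F' → F` with `g(1) = 1`). [folklore] -/
theorem isIntegrallyClosed_of_baseChange {F : Type} [Field F] (A : Type) [CommRing A] [Algebra F A] [IsDomain A]
    (F' : Type) [Field F'] [Algebra F F'] [IsDomain (A ⊗[F] F')] [IsIntegrallyClosed (A ⊗[F] F')] :
    IsIntegrallyClosed A := by
  -- an `F`-linear retraction of `F → F'`
  obtain ⟨g, hg⟩ := LinearMap.exists_leftInverse_of_injective (Algebra.linearMap F F')
    (LinearMap.ker_eq_bot.mpr (algebraMap F F').injective)
  have hg1 : g 1 = 1 := by
    have := LinearMap.congr_fun hg (1 : F)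
    simpa using this
  let ρ : A ⊗[F] F' →ₗ[F] A := tensorRetraction A g
  refine isIntegrallyClosed_of_retraction (Algebra.TensorProduct.includeLeft (R := F) (S := F) (A := A) (B := F')).toRingHom
    ρ.toAddMonoidHom (fun r => ?_) (fun b s => ?_)
  · change ρ (r ⊗ₜ 1) = r
    rw [tensorRetraction_tmul, hg1, one_smul]
  · change ρ (b * s ⊗ₜ 1) = ρ b * s
    induction b using TensorProduct.induction_on with
    | zero => simp
    | tmul a x =>
      rw [Algebra.TensorProduct.tmul_mul_tmul, mul_one, tensorRetraction_tmul, tensorRetraction_tmul, smul_mul_assoc]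
    | add b₁ b₂ h₁ h₂ => rw [add_mul, map_add, map_add, h₁, h₂, add_mul]

/-- **Integrality descends too**: `A` is a domain as soon as `A ⊗_F F'` is (the retraction makes
`A → A ⊗_F F'` injective). [folklore] -/
theorem isDomain_of_baseChange {F : Type} [Field F] (A : Type) [CommRing A] [Algebra F A]
    (F' : Type) [Field F'] [Algebra F F'] [IsDomain (A ⊗[F] F')] : IsDomain A := by
  obtain ⟨g, hg⟩ := LinearMap.exists_leftInverse_of_injective (Algebra.linearMap F F')
    (LinearMap.ker_eq_bot.mpr (algebraMap F F').injective)
  have hg1 : g 1 = 1 := by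
    have := LinearMap.congr_fun hg (1 : F)
    simpa using this
  have hinj : Function.Injective
      (Algebra.TensorProduct.includeLeft (R := F) (S := F) (A := A) (B := F')).toRingHom := by
    intro a b h
    have h' := congrArg (tensorRetraction A g) h
    change tensorRetraction A g (a ⊗ₜ 1) = tensorRetraction A g (b ⊗ₜ 1) at h'
    rwa [tensorRetraction_tmul, tensorRetraction_tmul, hg1, one_smul, one_smul] at h'
  exact hinj.isDomain _

/-! ## §15 `u^p + y² + z²` versus `u^p − yz`: the change of variables over a field containing `√−1` (`p ≠ 2`) -/

section SumOfSquares

variable (F : Type) [Field F] (p : ℕ)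

/-- `s = X₀^p + X₁² + X₂² ∈ F[X₀,X₁,X₂]` (the Disproof's (s2) polynomial). [folklore] -/
def sosPoly : MvPolynomial (Fin 3) F := MvPolynomial.X 0 ^ p + MvPolynomial.X 1 ^ 2 + MvPolynomial.X 2 ^ 2

/-- The ring `F[u,y,z]/(u^p + y² + z²)`. [folklore] -/
abbrev SosRing : Type := MvPolynomial (Fin 3) F ⧸ Ideal.span {sosPoly F p}

variable {F} in
/-- `φ(s) = s`. [folklore] -/
theorem map_sosPoly {L : Type} [Field L] (φ : F →+* L) : MvPolynomial.map φ (sosPoly F p) = sosPoly L p := by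
  simp [sosPoly, MvPolynomial.map_X]

/-- `s(0) = 0` (`p ≠ 0`). [folklore] -/
theorem eval_zero_sosPoly (hp0 : p ≠ 0) : MvPolynomial.eval (0 : Fin 3 → F) (sosPoly F p) = 0 := by
  simp [sosPoly, hp0]

/-- `s ≠ 0` (value `1` at `(0,1,0)`). [folklore] -/
theorem sosPoly_ne_zero (hp0 : p ≠ 0) : sosPoly F p ≠ 0 := by
  intro h
  have := congrArg (MvPolynomial.eval ![(0 : F), 1, 0]) h
  simp [sosPoly, hp0] at this

/-- All partials of `s` vanish at the origin (`p ≥ 2`). [folklore] -/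
theorem eval_zero_pderiv_sosPoly [hp : Fact p.Prime] (i : Fin 3) :
    MvPolynomial.eval (0 : Fin 3 → F) (MvPolynomial.pderiv i (sosPoly F p)) = 0 := by
  have h2 : p - 1 ≠ 0 := by have := hp.out.two_le; omega
  fin_cases i <;> simp [sosPoly, Derivation.leibniz_pow, h2]

/-- The origin of `Spec F[u,y,z]/(u^p + y² + z²)`. [folklore] -/
def sosOrigin : Ideal (SosRing F p) :=
  (RingHom.ker (MvPolynomial.eval (0 : Fin 3 → F))).map (Ideal.Quotient.mk (Ideal.span {sosPoly F p}))

/-- `(s) ≤ ker (eval 0)`. [folklore] -/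
theorem span_sosPoly_le_ker (hp0 : p ≠ 0) :
    Ideal.span {sosPoly F p} ≤ RingHom.ker (MvPolynomial.eval (0 : Fin 3 → F)) := by
  rw [Ideal.span_le, Set.singleton_subset_iff]; exact eval_zero_sosPoly F p hp0

/-- The origin is prime. [folklore] -/
theorem sosOrigin_isPrime (hp0 : p ≠ 0) : (sosOrigin F p).IsPrime :=
  haveI := RingHom.ker_isPrime (MvPolynomial.eval (0 : Fin 3 → F))
  Ideal.map_isPrime_of_surjective Ideal.Quotient.mk_surjective
    (by rw [Ideal.mk_ker]; exact span_sosPoly_le_ker F p hp0)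

/-- **`F[u,y,z]/(u^p + y² + z²)` is NOT regular at the origin** (every prime `p`, every `F` of characteristic `p`).
[folklore] -/
theorem not_isRegularLocalRing_sosOrigin [hp : Fact p.Prime] [CharP F p] :
    haveI := sosOrigin_isPrime F p hp.out.ne_zero
    ¬ IsRegularLocalRing (Localization.AtPrime (sosOrigin F p)) := by
  haveI := sosOrigin_isPrime F p hp.out.ne_zero
  exact not_isRegularLocalRing_localization_of_pderiv_eval_eq_zero
    (0 : Fin 3 → F) (sosPoly_ne_zero F p hp.out.ne_zero) (eval_zero_sosPoly F p hp.out.ne_zero)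
    (eval_zero_pderiv_sosPoly F p) (sosOrigin F p)
    (TwistExponent.comap_map_mk_eq_of_le' _ _ (span_sosPoly_le_ker F p hp.out.ne_zero))

/-- **`F[u,y,z]/(u^p + y² + z²)` is NOT a regular ring.** [folklore] -/
theorem not_isRegularRing_sosRing [hp : Fact p.Prime] [CharP F p] : ¬ IsRegularRing (SosRing F p) := by
  intro h
  haveI := sosOrigin_isPrime F p hp.out.ne_zero
  exact not_isRegularLocalRing_sosOrigin F p (IsRegularRing.isRegularLocalRing_localization (sosOrigin F p))

variable {F p} in
/-- **The change of variables `y ↦ y + iz`, `z ↦ −y + iz`** over a field with `i² = −1` and `2 ≠ 0`: an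
`F`-algebra automorphism of `F[u,y,z]` (inverse `y ↦ (y − z)/2`, `z ↦ −i(y + z)/2`). [folklore] -/
def sosEquiv (i : F) (hi : i * i = -1) (h2 : (2 : F) ≠ 0) : MvPolynomial (Fin 3) F ≃ₐ[F] MvPolynomial (Fin 3) F :=
  have hC : MvPolynomial.C (σ := Fin 3) i * MvPolynomial.C i = -1 := by rw [← map_mul, hi, map_neg, map_one]
  have h2C : MvPolynomial.C (σ := Fin 3) (2⁻¹ : F) * 2 = 1 := by
    rw [← map_ofNat (MvPolynomial.C (σ := Fin 3) (R := F)) 2, ← map_mul, inv_mul_cancel₀ h2, map_one]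
  AlgEquiv.ofAlgHom
    (MvPolynomial.aeval ![MvPolynomial.X 0, MvPolynomial.X 1 + MvPolynomial.C i * MvPolynomial.X 2,
      -MvPolynomial.X 1 + MvPolynomial.C i * MvPolynomial.X 2])
    (MvPolynomial.aeval ![MvPolynomial.X 0, MvPolynomial.C (2⁻¹ : F) * (MvPolynomial.X 1 - MvPolynomial.X 2),
      MvPolynomial.C (-(i * 2⁻¹)) * (MvPolynomial.X 1 + MvPolynomial.X 2)])
    (by
      refine MvPolynomial.algHom_ext fun j => ?_
      fin_cases j
      · simp
      · simp only [Fin.mk_one, AlgHom.coe_comp, Function.comp_apply, MvPolynomial.aeval_X, Matrix.cons_val_one,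
          Matrix.head_cons, map_mul, MvPolynomial.algHom_C, MvPolynomial.algebraMap_eq, map_sub, Matrix.cons_val_zero,
          Matrix.cons_val_two, Matrix.tail_cons, AlgHom.coe_id, id_eq]
        linear_combination (MvPolynomial.X 1 : MvPolynomial (Fin 3) F) * h2C
      · simp only [Fin.reduceFinMk, AlgHom.coe_comp, Function.comp_apply, MvPolynomial.aeval_X, Matrix.cons_val_two,
          Matrix.tail_cons, Matrix.head_cons, map_mul, map_neg, MvPolynomial.algHom_C, MvPolynomial.algebraMap_eq,
          map_add, Matrix.cons_val_one, Matrix.cons_val_zero, AlgHom.coe_id, id_eq]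
        linear_combination (MvPolynomial.X 2 : MvPolynomial (Fin 3) F) * h2C -
          (MvPolynomial.C (2⁻¹ : F) * 2 * MvPolynomial.X 2) * hC)
    (by
      refine MvPolynomial.algHom_ext fun j => ?_
      fin_cases j
      · simp
      · simp only [Fin.mk_one, AlgHom.coe_comp, Function.comp_apply, MvPolynomial.aeval_X, Matrix.cons_val_one,
          Matrix.head_cons, map_add, map_mul, map_neg, MvPolynomial.algHom_C, MvPolynomial.algebraMap_eq,
          Matrix.cons_val_two, Matrix.tail_cons, Matrix.cons_val_zero, AlgHom.coe_id, id_eq]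
        linear_combination (MvPolynomial.X 1 : MvPolynomial (Fin 3) F) * h2C -
          (MvPolynomial.C (2⁻¹ : F) * (MvPolynomial.X 1 + MvPolynomial.X 2)) * hC
      · simp only [Fin.reduceFinMk, AlgHom.coe_comp, Function.comp_apply, MvPolynomial.aeval_X, Matrix.cons_val_two,
          Matrix.tail_cons, Matrix.head_cons, map_add, map_neg, map_mul, MvPolynomial.algHom_C,
          MvPolynomial.algebraMap_eq, Matrix.cons_val_one, Matrix.cons_val_zero, AlgHom.coe_id, id_eq]
        linear_combination (MvPolynomial.X 2 : MvPolynomial (Fin 3) F) * h2C -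
          (MvPolynomial.C (2⁻¹ : F) * (MvPolynomial.X 1 + MvPolynomial.X 2)) * hC)

/-- The change of variables sends `f = u^p − yz` to `s = u^p + y² + z²`. [folklore] -/
theorem sosEquiv_apPoly (i : F) (hi : i * i = -1) (h2 : (2 : F) ≠ 0) :
    sosEquiv i hi h2 (apPoly F p) = sosPoly F p := by
  have hC : MvPolynomial.C (σ := Fin 3) i * MvPolynomial.C i = -1 := by rw [← map_mul, hi, map_neg, map_one]
  simp only [sosEquiv, AlgEquiv.ofAlgHom_apply, apPoly, sosPoly, map_sub, map_pow, map_mul, MvPolynomial.aeval_X,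
    Matrix.cons_val_zero, Matrix.cons_val_one, Matrix.cons_val_two, Matrix.head_cons, Matrix.tail_cons]
  linear_combination (-(MvPolynomial.X 2 : MvPolynomial (Fin 3) F) ^ 2) * hC

/-- **`F[u,y,z]/(u^p − yz) ≅ F[u,y,z]/(u^p + y² + z²)`** over a field with `√−1` and `2 ≠ 0`. [folklore] -/
def apQuotEquivSos (i : F) (hi : i * i = -1) (h2 : (2 : F) ≠ 0) : ApQuot F p ≃+* SosRing F p :=
  Ideal.quotientEquiv (Ideal.span {apPoly F p}) (Ideal.span {sosPoly F p}) (sosEquiv i hi h2).toRingEquiv (by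
    rw [Ideal.map_span, Set.image_singleton]
    exact congrArg _ (congrArg _ (sosEquiv_apPoly F p i hi h2).symm))

/-- Over such a field, `F[u,y,z]/(u^p + y² + z²)` is a NORMAL DOMAIN (transport from `ApQuot`). [folklore] -/
theorem isDomain_and_isIntegrallyClosed_sosRing_of_sqrt [Fact p.Prime] [CharP F p] (i : F) (hi : i * i = -1)
    (h2 : (2 : F) ≠ 0) : IsDomain (SosRing F p) ∧ IsIntegrallyClosed (SosRing F p) := by
  haveI := isDomain_apQuot F p
  haveI := isIntegrallyClosed_apQuot F p
  haveI : IsDomain (SosRing F p) := (apQuotEquivSos F p i hi h2).symm.toMulEquiv.isDomain _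
  exact ⟨inferInstance, IsIntegrallyClosed.of_equiv (apQuotEquivSos F p i hi h2)⟩

/-! ## §16 Descent to every field of odd characteristic `p`: the near-miss (s2) verbatim -/

/-- **`F[u,y,z]/(u^p + y² + z²) ⊗_F F̄ ≅ F̄[u,y,z]/(u^p + y² + z²)`** (generic hypersurface base change). [folklore] -/
def sosRingTensorEquiv : SosRing F p ⊗[F] AlgebraicClosure F ≃+* SosRing (AlgebraicClosure F) p :=
  (hypTensorEquiv F (sosPoly F p) (AlgebraicClosure F)).trans
    (Ideal.quotEquivOfEq (by rw [map_sosPoly]))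

/-- **[OURS · L1 W8.2] NEAR-MISS (s2) OF Cruxes/PrimeFieldToPerfect/Disproof.lean, VERBATIM AND PROVED**: for every
odd prime `p` and EVERY field `F` of characteristic `p`, the hypersurface ring `Z_F = F[u,y,z]/(u^p + y² + z²)` is a
DOMAIN, is INTEGRALLY CLOSED (normal), and is NOT a regular ring. Over `F̄ ∋ √−1` the change of variables
`y ↦ y + iz`, `z ↦ −y + iz` identifies `Z_{F̄}` with the `A_{p−1}` ring `F̄[u,y,z]/(u^p − yz)` (normal domain:
`isIntegrallyClosed_apQuot`, constants of the derivation `a∂_a − b∂_b`); normality and integrality DESCEND along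
`F → F̄` (`isIntegrallyClosed_of_baseChange`, `isDomain_of_baseChange`: the pure subring `Z_F ⊂ Z_F ⊗_F F̄ = Z_{F̄}`);
non-regularity at the origin is the Jacobian criterion over `F` itself (`not_isRegularRing_sosRing`). Use (Disproof
§4): over `K = 𝔽_p(t)` the regular surface `x^p − t + y² + z² = 0` has every purely inseparable base change / Frobenius
twist equal to `Z`, its own normalisation, never smooth — «normalise the twists, never re-resolve» fails from
dimension `2` (the split form `x^p − t = yz`, every `p`, is Theorems/UniformComplexityCampaignW82TwistNormal*.lean).
The disprover may replace its `sorry` by this theorem (same binders, same `let`). Replaces the role of no printed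
item; NOT a statement of H. Hironaka's manuscript. [cite: PatakfalviWaldron2017, Thm 1.1 and §2.4] -/
theorem twistedSurface_normal_not_regular (p : ℕ) [hp : Fact p.Prime] (hp2 : p ≠ 2)
    (F : Type) [Field F] [CharP F p] :
    let f : MvPolynomial (Fin 3) F :=
      MvPolynomial.X 0 ^ p + MvPolynomial.X 1 ^ 2 + MvPolynomial.X 2 ^ 2
    IsDomain (MvPolynomial (Fin 3) F ⧸ Ideal.span {f}) ∧
      IsIntegrallyClosed (MvPolynomial (Fin 3) F ⧸ Ideal.span {f}) ∧
      ¬ IsRegularRing (MvPolynomial (Fin 3) F ⧸ Ideal.span {f}) := by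
  show IsDomain (SosRing F p) ∧ IsIntegrallyClosed (SosRing F p) ∧ ¬ IsRegularRing (SosRing F p)
  let E := AlgebraicClosure F
  haveI : CharP E p := charP_of_injective_algebraMap (algebraMap F E).injective p
  -- `√−1 ∈ F̄` and `2 ≠ 0` in `F̄`
  obtain ⟨i, hi⟩ : ∃ i : E, i ^ 2 = -1 := IsAlgClosed.exists_pow_nat_eq _ two_pos
  have hi' : i * i = -1 := by rw [← pow_two]; exact hi
  have h2 : (2 : E) ≠ 0 := by
    have h : ((2 : ℕ) : E) ≠ 0 := fun h0 =>
      hp2 (((Nat.prime_dvd_prime_iff_eq hp.out Nat.prime_two).mp ((CharP.cast_eq_zero_iff E p 2).mp h0)))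
    simpa using h
  obtain ⟨hdomE, hnormE⟩ := isDomain_and_isIntegrallyClosed_sosRing_of_sqrt E p i hi' h2
  haveI := hdomE
  haveI := hnormE
  -- transport to `Z_F ⊗_F F̄`
  haveI : IsDomain (SosRing F p ⊗[F] E) := (sosRingTensorEquiv F p).toMulEquiv.isDomain _
  haveI : IsIntegrallyClosed (SosRing F p ⊗[F] E) := IsIntegrallyClosed.of_equiv (sosRingTensorEquiv F p).symm
  -- descend
  haveI : IsDomain (SosRing F p) := isDomain_of_baseChange (F := F) (SosRing F p) E
  exact ⟨inferInstance, isIntegrallyClosed_of_baseChange (F := F) (SosRing F p) E, not_isRegularRing_sosRing F p⟩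

end SumOfSquares

end Summit.ResolutionOfSingularities.ResolutionOfSingularities.Theorems.CampaignW82.TwistNormal

end
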